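import Literature.NumberTheory.LFunctions.DirichletLTruncationPacked
import HarnessLib

/-!
# Packed truncation certificates — the dyadic segment walk preserves leaf invariants

Generic frame lemma for the soundness of `LTruncationPacked.certTcells`: if every LEAF step of `seg` carries a position-indexed,
cell-aligned invariant `Inv n₀` of the state list to `Inv (n₀ + L)`, then so does the whole dyadic walk `seg … e n₀ len …`
(induction on the splitting depth, slicing the packed sign tables with `kpack_land_low` / `kpack_shiftRight_high`).
[cite: Chua2005RealZeros, §2.2 ALGO 1] [cite: GathenGerhard2013ModernComputerAlgebra, §8.4 (Kronecker substitution)]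
-/

namespace Literature.NumberTheory.LFunctions

namespace LTruncationPacked

open Finset FeketePolyaKernel LTruncationCert Literature.Analysis.Convolution

/-- **Segment walk.** `dP, dM ≤ 1` are the sign digits (digit `t` of the tables ↔ index `n₀ + t`); `Inv n₀` a cell-aligned invariant
carried by every leaf `[n₀, n₀+L)` with `1 ≤ n₀`, `1 ≤ L`; then `seg` carries `Inv n₀` to `Inv (n₀ + len)` (any depth `e`).
[cite: Chua2005RealZeros, §2.2 ALGO 1] -/
theorem seg_spec {b P J G : ℕ} (hb : 1 ≤ b) {dP dM : ℕ → ℕ} (hdP : ∀ n, dP n ≤ 1) (hdM : ∀ n, dM n ≤ 1)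
    (cells : List (ℕ × ℕ)) (Inv : ℕ → (ℕ × ℕ) → (ℤ × ℕ) → Prop)
    (hleaf : ∀ (n₀ L : ℕ) (st st' : List (ℤ × ℕ)), 1 ≤ n₀ → 1 ≤ L →
      List.Forall₂ (Inv n₀) cells st →
      leaf b P J n₀ L (kpack b L fun t => dP (n₀ + t)) (kpack b L fun t => dM (n₀ + t)) cells st = some st' →
      List.Forall₂ (Inv (n₀ + L)) cells st') :
    ∀ (e n₀ len : ℕ) (st st' : List (ℤ × ℕ)), 1 ≤ n₀ →
      List.Forall₂ (Inv n₀) cells st →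
      seg b P J G cells e n₀ len (kpack b len fun t => dP (n₀ + t)) (kpack b len fun t => dM (n₀ + t)) st = some st' →
      List.Forall₂ (Inv (n₀ + len)) cells st' := by
  have h2b : (1 : ℕ) < 2 ^ b := by
    calc (1 : ℕ) < 2 ^ 1 := by norm_num
      _ ≤ 2 ^ b := Nat.pow_le_pow_right (by norm_num) hb
  have hdPb : ∀ n, dP n < 2 ^ b := fun n => lt_of_le_of_lt (hdP n) h2b
  have hdMb : ∀ n, dM n < 2 ^ b := fun n => lt_of_le_of_lt (hdM n) h2b
  -- a non-empty segment handed to `leaf`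
  have hleaf' : ∀ (n₀ len : ℕ) (st st' : List (ℤ × ℕ)), 1 ≤ n₀ → len ≠ 0 →
      List.Forall₂ (Inv n₀) cells st →
      leaf b P J n₀ len (kpack b len fun t => dP (n₀ + t)) (kpack b len fun t => dM (n₀ + t)) cells st = some st' →
      List.Forall₂ (Inv (n₀ + len)) cells st' :=
    fun n₀ len st st' hn₀ hlen hinv h => hleaf n₀ len st st' hn₀ (Nat.one_le_iff_ne_zero.mpr hlen) hinv h
  intro e
  induction e with
  | zero =>
    intro n₀ len st st' hn₀ hinv h
    rw [seg] at h
    by_cases hlen : len = 0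
    · subst hlen
      simp only [show Nat.beq 0 0 = true from rfl, cond_true, Option.some.injEq] at h
      rw [← h, Nat.add_zero]; exact hinv
    · have hbeq : Nat.beq len 0 = false := by
        cases hq : Nat.beq len 0
        · rfl
        · exact absurd (Nat.eq_of_beq_eq_true hq) hlen
      simp only [hbeq, cond_false] at h
      exact hleaf' n₀ len st st' hn₀ hlen hinv h
  | succ e ih =>
    intro n₀ len st st' hn₀ hinv h
    rw [seg] at h
    by_cases hlen : len = 0
    · subst hlen
      simp only [show Nat.beq 0 0 = true from rfl, cond_true, Option.some.injEq] at h
      rw [← h, Nat.add_zero]; exact hinv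
    have hbeq : Nat.beq len 0 = false := by
      cases hq : Nat.beq len 0
      · rfl
      · exact absurd (Nat.eq_of_beq_eq_true hq) hlen
    simp only [hbeq, cond_false, Nat.one_shiftLeft] at h
    cases hfit : Nat.ble len (max 1 (n₀ / G)) with
    | true =>
      simp only [hfit, cond_true] at h
      exact hleaf' n₀ len st st' hn₀ hlen hinv h
    | false =>
      simp only [hfit, cond_false] at h
      -- split into halves
      have hle : len / 2 ≤ len := Nat.div_le_self len 2
      obtain ⟨r, hr⟩ : ∃ r, len = len / 2 + r := ⟨len - len / 2, by omega⟩
      have hlowp : (kpack b len fun t => dP (n₀ + t)) &&& (2 ^ (b * (len / 2)) - 1) =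
          kpack b (len / 2) fun t => dP (n₀ + t) := kpack_land_low hle fun j _ => hdPb _
      have hlowm : (kpack b len fun t => dM (n₀ + t)) &&& (2 ^ (b * (len / 2)) - 1) =
          kpack b (len / 2) fun t => dM (n₀ + t) := kpack_land_low hle fun j _ => hdMb _
      have hhighp : (kpack b len fun t => dP (n₀ + t)) >>> (b * (len / 2)) =
          kpack b (len - len / 2) fun t => dP (n₀ + len / 2 + t) := by
        rw [show (kpack b len fun t => dP (n₀ + t)) = kpack b (len / 2 + r) fun t => dP (n₀ + t) from by rw [← hr],
          kpack_shiftRight_high fun j _ => hdPb _, show len - len / 2 = r by omega]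
        exact kpack_congr fun i _ => by rw [add_assoc]
      have hhighm : (kpack b len fun t => dM (n₀ + t)) >>> (b * (len / 2)) =
          kpack b (len - len / 2) fun t => dM (n₀ + len / 2 + t) := by
        rw [show (kpack b len fun t => dM (n₀ + t)) = kpack b (len / 2 + r) fun t => dM (n₀ + t) from by rw [← hr],
          kpack_shiftRight_high fun j _ => hdMb _, show len - len / 2 = r by omega]
        exact kpack_congr fun i _ => by rw [add_assoc]
      rw [hlowp, hlowm, hhighp, hhighm] at h
      rcases hlow : seg b P J G cells e n₀ (len / 2) (kpack b (len / 2) fun t => dP (n₀ + t))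
          (kpack b (len / 2) fun t => dM (n₀ + t)) st with _ | st₁
      · rw [hlow] at h; simp at h
      rw [hlow] at h
      simp only at h
      have hinv₁ := ih n₀ (len / 2) st st₁ hn₀ hinv hlow
      have hinv₂ := ih (n₀ + len / 2) (len - len / 2) st₁ st' (by omega) hinv₁ h
      rwa [show n₀ + len / 2 + (len - len / 2) = n₀ + len by omega] at hinv₂

end LTruncationPacked

end Literature.NumberTheory.LFunctions
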